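/-
Copyright (c) 2026. All rights reserved.
Released under Apache 2.0 license as described in the file LICENSE.
Authors: HodgeCM publication cell (pub-hodgecm), model-construction sub-cell, construction prover `mc-theta-1` (gen 5).
-/
import Literature.RepresentationTheory.KonnoKonno2007.JunctionHyperbolicDerivative
import Literature.RepresentationTheory.KonnoKonno2007.JunctionDegreeOneKTypes
import Literature.Analysis.SegalBargmann.HermiteMultiplierDerivative
import Literature.Analysis.SegalBargmann.SchwartzOneParameterWords
import HarnessLib

/-!
# The smooth one-parameter families of the junction: boosts, tori, and the `K`-letters of an archimedean Weil datum

Topic `RepresentationTheory/KonnoKonno2007`; namespace `Literature.RepresentationTheory.KonnoKonno2007.RealDualPair`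
(with two carrier-level lemmas in `Literature.Analysis.SegalBargmann`).  For the junction
`Ginf P Q R S = U(P,Q) × U(R,S)` acting on `𝓢(ℝ^{DPIdx P Q R S})` (Folland 1989, Ch. 4) this file verifies that
the explicit one-parameter families through which an archimedean Weil datum `ω` (`IsArchWeilDatum`) acts are
**smooth one-parameter families of Schwartz operators** in the sense of
`Literature.Analysis.SegalBargmann.IsSmoothOneParam` (`SchwartzOneParameterWords`: group law, strong derivative
at `0`, local equicontinuity in seminorm form):

* `isSeminormBounded_image_leviS` — Levi dilations `f ↦ |det a|^{-1/2} f ∘ a⁻¹` with `‖a⁻¹ − 1‖ ≤ 1/2` and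
  bounded Levi factor are bounded in seminorm form (`SchwartzLinearFlowEstimates.seminorm_compCLM_sub_le`);
* `isSmoothOneParam_hypLevi`, **`isSmoothOneParam_hypOp`** — the hyperbolic Levi family `δ_{e^t}` and the boost
  family `hypOp t = μ₀(u)⁻¹ ∘ leviS(δ_{e^t}) ∘ μ₀(u)` (`JunctionHyperbolicFamily`), generators `hypLeviGen`,
  `hypOpGen` (`JunctionHyperbolicDerivative`, here upgraded to complex-linear operators `genOfSlope`);
* `isSmoothOneParam_torusOpCLM`, `isSmoothOneParam_torusOpPi` — the oscillator torus `s ↦ e^{i s v·N}` on the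
  Hermite and Folland carriers (`HermiteMultiplierDerivative.tendsto_slope_torusOpCLM_zero`,
  `HermiteMultiplierStrongContinuity.exists_seminorm_torusOpCLM_le_sup_seminorm`);
* the `K`-letters: for `a : P → ℝ`, `b : Q → ℝ` the compact one-parameter subgroup
  `torusK a b s = ((diag e^{-isa}, diag e^{-isb}), 1) ∈ (U(P)×U(Q))×(U(R)×U(S))`, the identities
  `dualPairι (torusK a b s) = diagHom (torusPt (s • torusIdxWt a b))`,
  `vacScalar e (torusK a b s) = exp(i · vacRate e a b · s)`, and — for a datum with vacuum clause
  `ω (κ k) h₀ = vacScalar e k • h₀` — **`weilDatum_apply_κ_torusK`**: `ω (κ (torusK a b s)) f = torusKOp e a b s f`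
  with **`isSmoothOneParam_torusKOp`**; together with the boost pin `weilDatum_apply_hypV_eq_hypOp`
  (`JunctionHyperbolicVacuumPin`) and the fixed operators `κOp e k₀ = vacScalar e k₀ • μ₀(dualPairι k₀)`
  (`weilDatum_apply_κ_eq_κOp`) these are the letters of the words `ω(∏ exp(t_i X_i))` differentiated in
  `JunctionArchDifferentiable`.

Everything is proved from Mathlib and the imported tree files; no cited fact is used as a hypothesis; 0 records.

## References

* G. B. Folland, *Harmonic Analysis in Phase Space*, Annals of Mathematics Studies 122 (1989): Ch. 4, (4.24),
  Prop. (4.39), §4.2 p. 156 (Schur remark), §1.7 (the oscillator torus). [cite: Folland1989, (4.24)]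

## Provenance

Written for the tree under the LEAN-IN-TREE rule by the pub-hodgecm formalisation cell (model-construction sub-cell,
theta-kernel lane mc-theta-1, node (AN) of «W6b-hol»).  Nothing here is specific to that cell.
-/

set_option autoImplicit false

noncomputable section

open Matrix Complex MeasureTheory Filter SchwartzMap
open scoped Topology SchwartzMap ComplexConjugate
open Literature.Analysis.SegalBargmann Literature.Analysis.Distribution Literature.NumberTheory.Weil1964

/-! ## §1  Complex-linear generators from complex-linear families -/

namespace Literature.Analysis.SegalBargmann

variable {D : Type*} [NormedAddCommGroup D] [NormedSpace ℝ D]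

/-- **A real-linear strong derivative of a family of complex-linear operators is complex-linear**: if
`h⁻¹ • (U h f − f) → G f` for every `f`, with `U h` complex-linear, then `G (c • f) = c • G f`; the upgraded
operator. [folklore] -/
def genOfSlope (U : ℝ → 𝓢(D, ℂ) →L[ℂ] 𝓢(D, ℂ)) (G : 𝓢(D, ℂ) →L[ℝ] 𝓢(D, ℂ))
    (hs : ∀ f, Tendsto (fun h : ℝ => h⁻¹ • (U h f - f)) (𝓝[≠] 0) (𝓝 (G f))) :
    𝓢(D, ℂ) →L[ℂ] 𝓢(D, ℂ) where
  toFun := G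
  map_add' := G.map_add
  map_smul' c f := by
    have h2 : Tendsto (fun h : ℝ => h⁻¹ • (U h (c • f) - c • f)) (𝓝[≠] 0) (𝓝 (c • G f)) := by
      refine ((hs f).const_smul c).congr fun h => ?_
      rw [map_smul, ← smul_sub]
      ext x
      simp only [_root_.smul_apply, _root_.sub_apply, smul_eq_mul, real_smul]
      ring
    exact tendsto_nhds_unique (hs (c • f)) h2
  cont := G.continuous

/-- unfolding. [folklore] -/
@[simp] theorem genOfSlope_apply (U : ℝ → 𝓢(D, ℂ) →L[ℂ] 𝓢(D, ℂ)) (G : 𝓢(D, ℂ) →L[ℝ] 𝓢(D, ℂ))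
    (hs : ∀ f, Tendsto (fun h : ℝ => h⁻¹ • (U h f - f)) (𝓝[≠] 0) (𝓝 (G f))) (f : 𝓢(D, ℂ)) :
    genOfSlope U G hs f = G f := rfl

/-- The real and complex Schwartz seminorms have the same values. [folklore] -/
theorem schwartzSeminorm_real_eq (k n : ℕ) (f : 𝓢(D, ℂ)) :
    SchwartzMap.seminorm ℝ k n f = SchwartzMap.seminorm ℂ k n f := rfl

end Literature.Analysis.SegalBargmann

/-! ## §2  Levi dilations near the identity are bounded in seminorm form -/

namespace Literature.Analysis.SegalBargmann

local notation "SR" σ => SchwartzMap (σ → ℝ) ℂ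

variable {σ : Type*} [Fintype σ]

/-- **Seminorm bound for a Levi dilation near the identity**: if `‖a⁻¹ − 1‖ ≤ 1/2` then
`p_{k,n}(leviS a f) ≤ ‖|det a|^{-1/2}‖ (2^{n+k+1} + n 2^n + 1) (p_{k,n} f + p_{k+1,n+1} f)`.
[cite: Folland1989, (4.24)] -/
theorem seminorm_leviS_le (a : (σ → ℝ) ≃ₗ[ℝ] (σ → ℝ))
    (ha : ‖((a.symm.toContinuousLinearEquiv : (σ → ℝ) ≃L[ℝ] (σ → ℝ)) : (σ → ℝ) →L[ℝ] (σ → ℝ)) - 1‖ ≤ 1 / 2)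
    (k n : ℕ) (f : SR σ) :
    SchwartzMap.seminorm ℂ k n (leviS a f) ≤
      ‖leviFactor a‖ * ((2 ^ (n + k + 1) + n * 2 ^ n + 1) *
        (SchwartzMap.seminorm ℂ k n f + SchwartzMap.seminorm ℂ (k + 1) (n + 1) f)) := by
  set L : (σ → ℝ) ≃L[ℝ] (σ → ℝ) := a.symm.toContinuousLinearEquiv with hL
  have hlevi : leviS a f = leviFactor a • SchwartzMap.compCLMOfContinuousLinearEquiv ℂ L f := rfl
  have hp : 0 ≤ SchwartzMap.seminorm ℂ k n f := apply_nonneg _ _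
  have hp' : 0 ≤ SchwartzMap.seminorm ℂ (k + 1) (n + 1) f := apply_nonneg _ _
  have hkey := seminorm_compCLM_sub_le (Φ := f) ℂ L ha k n
  rw [schwartzSeminorm_real_eq, schwartzSeminorm_real_eq, schwartzSeminorm_real_eq] at hkey
  have hcomp : SchwartzMap.seminorm ℂ k n (SchwartzMap.compCLMOfContinuousLinearEquiv ℂ L f) ≤
      (2 ^ (n + k + 1) + n * 2 ^ n + 1) *
        (SchwartzMap.seminorm ℂ k n f + SchwartzMap.seminorm ℂ (k + 1) (n + 1) f) := by
    calc SchwartzMap.seminorm ℂ k n (SchwartzMap.compCLMOfContinuousLinearEquiv ℂ L f)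
        = SchwartzMap.seminorm ℂ k n ((SchwartzMap.compCLMOfContinuousLinearEquiv ℂ L f - f) + f) := by
          rw [sub_add_cancel]
      _ ≤ SchwartzMap.seminorm ℂ k n (SchwartzMap.compCLMOfContinuousLinearEquiv ℂ L f - f) +
            SchwartzMap.seminorm ℂ k n f := map_add_le_add _ _ _
      _ ≤ (2 ^ (n + k + 1) * SchwartzMap.seminorm ℂ (k + 1) (n + 1) f
            + n * 2 ^ n * SchwartzMap.seminorm ℂ k n f) * ‖(L : (σ → ℝ) →L[ℝ] (σ → ℝ)) - 1‖ +
            SchwartzMap.seminorm ℂ k n f := by gcongr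
      _ ≤ (2 ^ (n + k + 1) * SchwartzMap.seminorm ℂ (k + 1) (n + 1) f
            + n * 2 ^ n * SchwartzMap.seminorm ℂ k n f) * 1 + SchwartzMap.seminorm ℂ k n f :=
          add_le_add_left (mul_le_mul_of_nonneg_left (ha.trans (by norm_num))
            (add_nonneg (mul_nonneg (by positivity) hp') (mul_nonneg (by positivity) hp))) _
      _ ≤ _ := by
          have h4 : (0 : ℝ) ≤ 2 ^ (n + k + 1) := by positivity
          have h5 : (0 : ℝ) ≤ n * 2 ^ n := by positivity
          nlinarith
  rw [hlevi, map_smul_eq_mul]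
  exact mul_le_mul_of_nonneg_left hcomp (norm_nonneg _)

/-- **Levi dilations near the identity are bounded in seminorm form**: for a family `a x` with
`‖(a x)⁻¹ − 1‖ ≤ 1/2` and `‖|det a x|^{-1/2}‖ ≤ M` on `s`, the operators `leviS (a x)`, `x ∈ s`, are bounded in
seminorm form. [cite: Folland1989, (4.24)] -/
theorem isSeminormBounded_image_leviS {X : Type*} (a : X → ((σ → ℝ) ≃ₗ[ℝ] (σ → ℝ))) (s : Set X) {M : ℝ}
    (hM0 : 0 ≤ M) (hM : ∀ x ∈ s, ‖leviFactor (a x)‖ ≤ M)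
    (h1 : ∀ x ∈ s, ‖(((a x).symm.toContinuousLinearEquiv : (σ → ℝ) ≃L[ℝ] (σ → ℝ)) :
      (σ → ℝ) →L[ℝ] (σ → ℝ)) - 1‖ ≤ 1 / 2) :
    IsSeminormBounded ((fun x => leviS (a x)) '' s) := by
  rintro ⟨k, n⟩
  refine ⟨{(k, n), (k + 1, n + 1)}, M * (2 ^ (n + k + 1) + n * 2 ^ n + 1), by positivity, ?_⟩
  rintro _ ⟨x, hx, rfl⟩ f
  have hne : (k, n) ≠ (k + 1, n + 1) := by simp
  rw [Finset.sum_pair hne]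
  simp only [schwartzSeminormFamily_apply]
  calc SchwartzMap.seminorm ℂ k n (leviS (a x) f)
      ≤ ‖leviFactor (a x)‖ * ((2 ^ (n + k + 1) + n * 2 ^ n + 1) *
          (SchwartzMap.seminorm ℂ k n f + SchwartzMap.seminorm ℂ (k + 1) (n + 1) f)) :=
        seminorm_leviS_le (a x) (h1 x hx) k n f
    _ ≤ M * ((2 ^ (n + k + 1) + n * 2 ^ n + 1) *
          (SchwartzMap.seminorm ℂ k n f + SchwartzMap.seminorm ℂ (k + 1) (n + 1) f)) :=
        mul_le_mul_of_nonneg_right (hM x hx) (by positivity)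
    _ = _ := by ring

end Literature.Analysis.SegalBargmann

/-! ## §3  The hyperbolic Levi family and the boost family are smooth one-parameter families -/

namespace Literature.RepresentationTheory.KonnoKonno2007

namespace RealDualPair

local notation "SR" σ => SchwartzMap (σ → ℝ) ℂ

section Hyp

variable {P Q : Type*} [Fintype P] [DecidableEq P] [Fintype Q] [DecidableEq Q]
  (R S : Type*) [Fintype R] [DecidableEq R] [Fintype S] [DecidableEq S] (p₀ : P) (q₀ : Q)

/-- The complex-linear generator of the hyperbolic Levi family. [cite: Folland1989, (4.24)] -/
def hypLeviGenC : (SR (DPIdx P Q R S)) →L[ℂ] SR (DPIdx P Q R S) :=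
  genOfSlope (hypLevi R S p₀ q₀) (hypLeviGen R S p₀ q₀) (tendsto_hypLevi_sub_div R S p₀ q₀)

/-- unfolding. [folklore] -/
@[simp] theorem hypLeviGenC_apply (f : SR (DPIdx P Q R S)) :
    hypLeviGenC R S p₀ q₀ f = hypLeviGen R S p₀ q₀ f := rfl

/-- The complex-linear generator of the boost family `hypOp`. [cite: Folland1989, (4.24)] -/
def hypOpGenC : (SR (DPIdx P Q R S)) →L[ℂ] SR (DPIdx P Q R S) :=
  genOfSlope (hypOp R S p₀ q₀) (hypOpGen R S p₀ q₀) (tendsto_hypOp_sub_div R S p₀ q₀)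

/-- unfolding. [folklore] -/
@[simp] theorem hypOpGenC_apply (f : SR (DPIdx P Q R S)) :
    hypOpGenC R S p₀ q₀ f = hypOpGen R S p₀ q₀ f := rfl

omit [DecidableEq R] [DecidableEq S] in
/-- **Near `t = 0` the inverse dilations `δ_{e^t}⁻¹` are within `1/2` of the identity** in operator norm.
[folklore] -/
theorem exists_norm_planeDil_exp_symm_sub_one_le :
    ∃ δ : ℝ, 0 < δ ∧ ∀ t ∈ Set.Icc (-δ) δ,
      ‖(((planeDil R S p₀ q₀ (Real.exp t) (Real.exp_pos t).ne').symm.toContinuousLinearEquiv :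
          (DPIdx P Q R S → ℝ) ≃L[ℝ] (DPIdx P Q R S → ℝ)) : (DPIdx P Q R S → ℝ) →L[ℝ] (DPIdx P Q R S → ℝ)) - 1‖
        ≤ 1 / 2 := by
  have ht : Tendsto (fun t : ℝ => ‖Real.exp (-t) - 1‖ * ‖planeProjCLM R S p₀ q₀‖) (𝓝 0) (𝓝 0) := by
    have h : Continuous fun t : ℝ => ‖Real.exp (-t) - 1‖ * ‖planeProjCLM R S p₀ q₀‖ :=
      ((Real.continuous_exp.comp continuous_neg).sub continuous_const).norm.mul continuous_const
    simpa using h.tendsto 0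
  obtain ⟨ε, hε, hball⟩ := Metric.eventually_nhds_iff.1 (ht.eventually_lt_const (by norm_num : (0 : ℝ) < 1 / 2))
  refine ⟨ε / 2, half_pos hε, fun t ht => ?_⟩
  rw [planeDil_exp_symm_toCLM, add_sub_cancel_left]
  refine (norm_smul_le _ _).trans (hball ?_).le
  rw [Real.dist_eq, sub_zero]
  exact (abs_le.2 ht).trans_lt (half_lt_self hε)

/-- **The hyperbolic Levi family is bounded in seminorm form near `t = 0`.** [cite: Folland1989, (4.24)] -/
theorem exists_isSeminormBounded_hypLevi :
    ∃ δ : ℝ, 0 < δ ∧ IsSeminormBounded (hypLevi R S p₀ q₀ '' Set.Icc (-δ) δ) := by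
  obtain ⟨δ, hδ, h1⟩ := exists_norm_planeDil_exp_symm_sub_one_le R S p₀ q₀
  refine ⟨δ, hδ, ?_⟩
  have hM : ∀ t ∈ Set.Icc (-δ) δ,
      ‖leviFactor (planeDil R S p₀ q₀ (Real.exp t) (Real.exp_pos t).ne')‖ ≤ Real.exp (|hypWt R S| * δ) := by
    intro t ht
    rw [leviFactor_planeDil_exp, Complex.norm_real, Real.norm_eq_abs, abs_of_pos (Real.exp_pos _),
      Real.exp_le_exp]
    calc hypWt R S * t ≤ |hypWt R S * t| := le_abs_self _
      _ = |hypWt R S| * |t| := abs_mul _ _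
      _ ≤ |hypWt R S| * δ := mul_le_mul_of_nonneg_left (abs_le.2 ht) (abs_nonneg _)
  exact isSeminormBounded_image_leviS
    (fun t : ℝ => planeDil R S p₀ q₀ (Real.exp t) (Real.exp_pos t).ne') (Set.Icc (-δ) δ)
    (Real.exp_pos _).le hM h1

/-- **The hyperbolic Levi family `t ↦ leviS(δ_{e^t})` is a smooth one-parameter family of Schwartz operators**
(group law, strong derivative `hypLeviGen` at `0`, local equicontinuity). [cite: Folland1989, (4.24)] -/
theorem isSmoothOneParam_hypLevi :
    IsSmoothOneParam (hypLevi R S p₀ q₀) (hypLeviGenC R S p₀ q₀) where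
  map_zero := hypLevi_zero R S p₀ q₀
  map_add := hypLevi_add R S p₀ q₀
  slope := tendsto_hypLevi_sub_div R S p₀ q₀
  bound := exists_isSeminormBounded_hypLevi R S p₀ q₀

/-- **The boost family `t ↦ hypOp t` is a smooth one-parameter family of Schwartz operators** with generator
`hypOpGen` (group law `hypOp_add`, strong derivative `tendsto_hypOp_sub_div`, local equicontinuity transported
from the Levi family through the fixed operators `μ₀(u)^{±1}`). [cite: Folland1989, (4.24), Prop. (4.39)] -/
theorem isSmoothOneParam_hypOp :
    IsSmoothOneParam (hypOp R S p₀ q₀) (hypOpGenC R S p₀ q₀) where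
  map_zero := hypOp_zero R S p₀ q₀
  map_add := hypOp_add R S p₀ q₀
  slope := tendsto_hypOp_sub_div R S p₀ q₀
  bound := by
    obtain ⟨δ, hδ, hb⟩ := exists_isSeminormBounded_hypLevi R S p₀ q₀
    refine ⟨δ, hδ, ?_⟩
    refine ((isSeminormBounded_singleton (unitaryOpPi (frameU R S p₀ q₀)⁻¹)).comp
      (hb.comp (isSeminormBounded_singleton (unitaryOpPi (frameU R S p₀ q₀))))).mono ?_
    rintro _ ⟨t, ht, rfl⟩
    exact ⟨_, rfl, _, ⟨_, ⟨t, ht, rfl⟩, _, rfl, rfl⟩, rfl⟩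

end Hyp

end RealDualPair

end Literature.RepresentationTheory.KonnoKonno2007

/-! ## §4  Transport of smooth one-parameter families between Schwartz carriers; the oscillator torus -/

namespace Literature.Analysis.SegalBargmann

variable {D : Type*} [NormedAddCommGroup D] [NormedSpace ℝ D] {D' : Type*} [NormedAddCommGroup D'] [NormedSpace ℝ D']

/-- **Seminorm bound of one continuous linear map between Schwartz spaces.** [folklore] -/
theorem exists_seminorm_clm_le (A : 𝓢(D, ℂ) →L[ℂ] 𝓢(D', ℂ)) (i : ℕ × ℕ) :
    ∃ (s : Finset (ℕ × ℕ)) (C : ℝ), 0 ≤ C ∧ ∀ f : 𝓢(D, ℂ),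
      schwartzSeminormFamily ℂ D' ℂ i (A f) ≤ C * ∑ j ∈ s, schwartzSeminormFamily ℂ D ℂ j f := by
  set q : Seminorm ℂ 𝓢(D, ℂ) := (schwartzSeminormFamily ℂ D' ℂ i).comp (A : 𝓢(D, ℂ) →ₗ[ℂ] 𝓢(D', ℂ)) with hq
  have hqc : Continuous q := ((schwartz_withSeminorms ℂ D' ℂ).continuous_seminorm i).comp A.continuous
  obtain ⟨s, C, -, hle⟩ := Seminorm.bound_of_continuous (schwartz_withSeminorms ℂ D ℂ) q hqc
  refine ⟨s, C, C.coe_nonneg, fun f => ?_⟩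
  calc schwartzSeminormFamily ℂ D' ℂ i (A f) = q f := rfl
    _ ≤ (C • s.sup (schwartzSeminormFamily ℂ D ℂ)) f := hle f
    _ = C * (s.sup (schwartzSeminormFamily ℂ D ℂ)) f := by simp [NNReal.smul_def]
    _ ≤ C * ∑ j ∈ s, schwartzSeminormFamily ℂ D ℂ j f := by
        gcongr; exact finset_sup_schwartzSeminormFamily_le_sum s f

/-- **Transport of a seminorm-bounded family through fixed continuous linear maps** `U ↦ A ∘ U ∘ B` between two
Schwartz carriers. [folklore] -/
theorem IsSeminormBounded.transport (A : 𝓢(D, ℂ) →L[ℂ] 𝓢(D', ℂ)) (B : 𝓢(D', ℂ) →L[ℂ] 𝓢(D, ℂ))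
    {𝓕 : Set (𝓢(D, ℂ) →L[ℂ] 𝓢(D, ℂ))} (h : IsSeminormBounded 𝓕) :
    IsSeminormBounded ((fun U => A.comp (U.comp B)) '' 𝓕) := by
  intro i
  obtain ⟨s₁, C₁, hC₁, h₁⟩ := exists_seminorm_clm_le A i
  choose s₂ C₂ hC₂ h₂ using h
  choose s₃ C₃ hC₃ h₃ using exists_seminorm_clm_le B
  set S₂ : Finset (ℕ × ℕ) := s₁.biUnion s₂ with hS₂
  set S₃ : Finset (ℕ × ℕ) := S₂.biUnion s₃ with hS₃
  refine ⟨S₃, C₁ * ∑ j ∈ s₁, (C₂ j * ∑ m ∈ S₂, C₃ m),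
    mul_nonneg hC₁ (Finset.sum_nonneg fun j _ => mul_nonneg (hC₂ j) (Finset.sum_nonneg fun m _ => hC₃ m)), ?_⟩
  rintro _ ⟨U, hU, rfl⟩ f
  have hnn : ∀ r, 0 ≤ schwartzSeminormFamily ℂ D' ℂ r f := fun r => apply_nonneg _ _
  -- innermost: `p_m (B f) ≤ C₃ m · Σ_{S₃} p_r f` for `m ∈ S₂`
  have hB : ∀ m ∈ S₂, schwartzSeminormFamily ℂ D ℂ m (B f) ≤ C₃ m * ∑ r ∈ S₃, schwartzSeminormFamily ℂ D' ℂ r f :=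
    fun m hm => (h₃ m f).trans (mul_le_mul_of_nonneg_left
      (Finset.sum_le_sum_of_subset_of_nonneg (Finset.subset_biUnion_of_mem s₃ hm) fun r _ _ => hnn r) (hC₃ m))
  -- middle: `p_j (U (B f)) ≤ C₂ j Σ_{m ∈ s₂ j} p_m (B f) ≤ C₂ j (Σ_{m ∈ S₂} C₃ m) Σ_{S₃} p_r f` for `j ∈ s₁`
  have hUB : ∀ j ∈ s₁, schwartzSeminormFamily ℂ D ℂ j (U (B f)) ≤
      (C₂ j * ∑ m ∈ S₂, C₃ m) * ∑ r ∈ S₃, schwartzSeminormFamily ℂ D' ℂ r f := by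
    intro j hj
    have hsub : s₂ j ⊆ S₂ := Finset.subset_biUnion_of_mem s₂ hj
    calc schwartzSeminormFamily ℂ D ℂ j (U (B f))
        ≤ C₂ j * ∑ m ∈ s₂ j, schwartzSeminormFamily ℂ D ℂ m (B f) := h₂ j U hU (B f)
      _ ≤ C₂ j * ∑ m ∈ S₂, schwartzSeminormFamily ℂ D ℂ m (B f) :=
          mul_le_mul_of_nonneg_left (Finset.sum_le_sum_of_subset_of_nonneg hsub fun m _ _ => apply_nonneg _ _)
            (hC₂ j)
      _ ≤ C₂ j * ∑ m ∈ S₂, C₃ m * ∑ r ∈ S₃, schwartzSeminormFamily ℂ D' ℂ r f :=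
          mul_le_mul_of_nonneg_left (Finset.sum_le_sum hB) (hC₂ j)
      _ = (C₂ j * ∑ m ∈ S₂, C₃ m) * ∑ r ∈ S₃, schwartzSeminormFamily ℂ D' ℂ r f := by
          rw [← Finset.sum_mul]; ring
  calc schwartzSeminormFamily ℂ D' ℂ i ((A.comp (U.comp B)) f)
      ≤ C₁ * ∑ j ∈ s₁, schwartzSeminormFamily ℂ D ℂ j (U (B f)) := h₁ (U (B f))
    _ ≤ C₁ * ∑ j ∈ s₁, (C₂ j * ∑ m ∈ S₂, C₃ m) * ∑ r ∈ S₃, schwartzSeminormFamily ℂ D' ℂ r f :=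
        mul_le_mul_of_nonneg_left (Finset.sum_le_sum hUB) hC₁
    _ = (C₁ * ∑ j ∈ s₁, (C₂ j * ∑ m ∈ S₂, C₃ m)) * ∑ r ∈ S₃, schwartzSeminormFamily ℂ D' ℂ r f := by
        rw [← Finset.sum_mul]; ring

/-- **Transport of a smooth one-parameter family through a topological isomorphism of Schwartz carriers**:
`s ↦ A ∘ U s ∘ A⁻¹` is smooth with generator `A ∘ G ∘ A⁻¹`. [folklore] -/
theorem IsSmoothOneParam.transport {U : ℝ → 𝓢(D, ℂ) →L[ℂ] 𝓢(D, ℂ)} {G : 𝓢(D, ℂ) →L[ℂ] 𝓢(D, ℂ)}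
    (hU : IsSmoothOneParam U G) (A : 𝓢(D, ℂ) ≃L[ℂ] 𝓢(D', ℂ)) :
    IsSmoothOneParam
      (fun s => (A : 𝓢(D, ℂ) →L[ℂ] 𝓢(D', ℂ)).comp ((U s).comp (A.symm : 𝓢(D', ℂ) →L[ℂ] 𝓢(D, ℂ))))
      ((A : 𝓢(D, ℂ) →L[ℂ] 𝓢(D', ℂ)).comp (G.comp (A.symm : 𝓢(D', ℂ) →L[ℂ] 𝓢(D, ℂ)))) := by
  refine ⟨?_, fun s t => ?_, fun f => ?_, ?_⟩
  · rw [hU.map_zero]; ext f; simp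
  · rw [hU.map_add]; ext f; simp
  · have hg := hU.slope (A.symm f)
    have hA := ((A : 𝓢(D, ℂ) →L[ℂ] 𝓢(D', ℂ)).continuous.tendsto _).comp hg
    refine hA.congr fun h => ?_
    show (A : 𝓢(D, ℂ) →L[ℂ] 𝓢(D', ℂ)) (h⁻¹ • (U h (A.symm f) - A.symm f)) = h⁻¹ • (A (U h (A.symm f)) - f)
    rw [ContinuousLinearMap.map_smul_of_tower, map_sub, ContinuousLinearEquiv.coe_coe,
      ContinuousLinearEquiv.apply_symm_apply]
  · obtain ⟨δ, hδ, hb⟩ := hU.bound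
    refine ⟨δ, hδ, (hb.transport (A : 𝓢(D, ℂ) →L[ℂ] 𝓢(D', ℂ)) (A.symm : 𝓢(D', ℂ) →L[ℂ] 𝓢(D, ℂ))).mono ?_⟩
    rintro _ ⟨s, hs, rfl⟩
    exact ⟨U s, ⟨s, hs, rfl⟩, rfl⟩

section Torus

variable {σ : Type*} [Fintype σ] [DecidableEq σ]

local notation "SR" σ => SchwartzMap (σ → ℝ) ℂ

/-- **The oscillator torus `s ↦ e^{i s v·N}` on the Hermite carrier is a smooth one-parameter family** with generator
the Hermite multiplier `h_β ↦ i (v·β) h_β` (`tendsto_slope_torusOpCLM_zero`; the bound is uniform on the whole torus,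
`exists_seminorm_torusOpCLM_le_sup_seminorm`). [cite: Folland1989, §1.7] -/
theorem isSmoothOneParam_torusOpCLM (v : σ → ℝ) :
    IsSmoothOneParam (fun s : ℝ => torusOpCLM (s • v))
      (hermiteMultiplierCLM (fun β => I * torusGenMult v β) (isPolyBounded_I_mul_torusGenMult v)) := by
  refine ⟨by rw [zero_smul, torusOpCLM_zero], fun s t => by rw [add_smul, torusOpCLM_add],
    fun f => tendsto_slope_torusOpCLM_zero v f, ⟨1, one_pos, ?_⟩⟩
  rintro ⟨k, l⟩
  obtain ⟨s, C, hC, hle⟩ := exists_seminorm_torusOpCLM_le_sup_seminorm (σ := σ) k l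
  refine ⟨s, C, hC, ?_⟩
  rintro _ ⟨t, -, rfl⟩ f
  rw [schwartzSeminormFamily_apply]
  exact (hle (t • v) f).trans (mul_le_mul_of_nonneg_left (finset_sup_schwartzSeminormFamily_le_sum s f) hC)

/-- The generator of the oscillator torus on the Folland carrier `𝓢(ℝ^σ)`: the transport of the Hermite multiplier
`h_β ↦ i (v·β) h_β`. [cite: Folland1989, §1.7] -/
def torusGenPi (v : σ → ℝ) : (SR σ) →L[ℂ] SR σ :=
  (schwartzTransport (euclE σ) : 𝓢(EuclideanSpace ℝ σ, ℂ) →L[ℂ] SR σ).comp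
    ((hermiteMultiplierCLM (fun β => I * torusGenMult v β) (isPolyBounded_I_mul_torusGenMult v)).comp
      ((schwartzTransport (euclE σ)).symm : (SR σ) →L[ℂ] 𝓢(EuclideanSpace ℝ σ, ℂ)))

/-- **The oscillator torus `s ↦ torusOpPi (s • v)` on the Folland carrier is a smooth one-parameter family** with
generator `torusGenPi v`. [cite: Folland1989, §1.7] -/
theorem isSmoothOneParam_torusOpPi (v : σ → ℝ) :
    IsSmoothOneParam (fun s : ℝ => torusOpPi (s • v)) (torusGenPi v) :=
  (isSmoothOneParam_torusOpCLM v).transport (schwartzTransport (euclE σ))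

end Torus

end Literature.Analysis.SegalBargmann

/-! ## §5  The `K`-letters of an archimedean Weil datum -/

namespace Literature.RepresentationTheory.KonnoKonno2007

namespace RealDualPair

local notation "SR" σ => SchwartzMap (σ → ℝ) ℂ

section KLetters

variable {P Q : Type*} [Fintype P] [DecidableEq P] [Fintype Q] [DecidableEq Q]
  {R S : Type*} [Fintype R] [DecidableEq R] [Fintype S] [DecidableEq S]

omit [Fintype P] [DecidableEq P] [Fintype Q] [DecidableEq Q] [Fintype R] [DecidableEq R] [Fintype S]
  [DecidableEq S] in
/-- `torusPt` is a homomorphism from `(ℝ^σ, +)`: `torusPt (θ + θ') = torusPt θ * torusPt θ'`. [folklore] -/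
theorem torusPt_add {σ : Type*} (θ θ' : σ → ℝ) : torusPt (θ + θ') = torusPt θ * torusPt θ' := by
  funext l
  simp only [torusPt, Pi.add_apply, Pi.mul_apply, neg_add, Circle.exp_add]

omit [Fintype P] [DecidableEq P] [Fintype Q] [DecidableEq Q] [Fintype R] [DecidableEq R] [Fintype S]
  [DecidableEq S] in
/-- `torusPt 0 = 1`. [folklore] -/
theorem torusPt_zero {σ : Type*} : torusPt (0 : σ → ℝ) = 1 := by
  funext l
  simp [torusPt]

variable (R S) in
/-- **The compact one-parameter subgroups of `K = U(P) × U(Q)` inside `K × K′`**: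
`torusK a b s = ((diag e^{-isa}, diag e^{-isb}), (1, 1))`. [folklore] -/
def torusK (a : P → ℝ) (b : Q → ℝ) (s : ℝ) : DPK P Q R S :=
  ((diagHom (torusPt (s • a)), diagHom (torusPt (s • b))), 1)

/-- `torusK a b 0 = 1`. [folklore] -/
@[simp] theorem torusK_zero (a : P → ℝ) (b : Q → ℝ) : torusK R S a b 0 = 1 := by
  simp only [torusK, zero_smul, torusPt_zero, map_one]
  rfl

/-- the group law `torusK a b (s + t) = torusK a b s * torusK a b t`. [folklore] -/
theorem torusK_add (a : P → ℝ) (b : Q → ℝ) (s t : ℝ) :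
    torusK R S a b (s + t) = torusK R S a b s * torusK R S a b t := by
  simp only [torusK, add_smul, torusPt_add, map_mul, Prod.mk_mul_mk, mul_one]

variable (R S) in
/-- The induced torus weights on the coordinates of `𝕎 = V ⊗ W`: `-a_p` on `P×R`, `-b_q` on `Q×S` (the conjugated
same-sign blocks), `a_p` on `P×S`, `b_q` on `Q×R`. [folklore] -/
def torusIdxWt (a : P → ℝ) (b : Q → ℝ) : DPIdx P Q R S → ℝ :=
  Sum.elim (Sum.elim (fun pr => -a pr.1) (fun qs => -b qs.1)) (Sum.elim (fun ps => a ps.1) (fun qr => b qr.1))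

/-- **The block datum of a torus letter is a torus point of `U(DPIdx)`**:
`dualPairι (torusK a b s) = diag (torusPt (s • torusIdxWt a b))`. [folklore] -/
theorem dualPairι_torusK (a : P → ℝ) (b : Q → ℝ) (s : ℝ) :
    dualPairι (torusK R S a b s) = diagHom (torusPt (s • torusIdxWt R S a b)) := by
  apply Subtype.ext
  rw [coe_dualPairι, coe_diagHom]
  have h1 : ((torusK R S a b s).1.1 : Matrix P P ℂ) = diagonal fun p => ((torusPt (s • a) p : Circle) : ℂ) := rfl
  have h2 : ((torusK R S a b s).1.2 : Matrix Q Q ℂ) = diagonal fun q => ((torusPt (s • b) q : Circle) : ℂ) := rfl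
  have h3 : ((torusK R S a b s).2.1 : Matrix R R ℂ) = diagonal fun _ => 1 := by
    show (((1 : Matrix.unitaryGroup R ℂ × Matrix.unitaryGroup S ℂ).1 : Matrix.unitaryGroup R ℂ) : Matrix R R ℂ) = _
    rw [Prod.fst_one, OneMemClass.coe_one, Matrix.diagonal_one]
  have h4 : ((torusK R S a b s).2.2 : Matrix S S ℂ) = diagonal fun _ => 1 := by
    show (((1 : Matrix.unitaryGroup R ℂ × Matrix.unitaryGroup S ℂ).2 : Matrix.unitaryGroup S ℂ) : Matrix S S ℂ) = _
    rw [Prod.snd_one, OneMemClass.coe_one, Matrix.diagonal_one]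
  rw [h1, h2, h3, h4, Matrix.diagonal_kronecker_diagonal, Matrix.diagonal_kronecker_diagonal,
    Matrix.diagonal_kronecker_diagonal, Matrix.diagonal_kronecker_diagonal, Matrix.diagonal_map (star_zero _),
    Matrix.diagonal_map (star_zero _), Matrix.fromBlocks_diagonal, Matrix.fromBlocks_diagonal,
    Matrix.fromBlocks_diagonal]
  congr 1
  funext l
  rcases l with ((⟨p, r⟩ | ⟨q, s'⟩) | (⟨p, s'⟩ | ⟨q, r⟩)) <;>
    simp [torusIdxWt, torusPt, Circle.exp_neg]
  all_goals
    rw [← Complex.exp_conj, ← Complex.exp_neg, map_mul, map_mul, Complex.conj_ofReal, Complex.conj_ofReal,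
      Complex.conj_I]
    congr 1
    ring

/-- the rate of the vacuum phase along a torus letter: `-(e_P Σ a + e_Q Σ b)`. [folklore] -/
def vacRate (e : VacExponents) (a : P → ℝ) (b : Q → ℝ) : ℝ := -(e.eP * ∑ p, a p + e.eQ * ∑ q, b q)

omit [DecidableEq R] [DecidableEq S] in
/-- `det (diag (torusPt θ)) = e^{-i Σ θ}`. [folklore] -/
theorem det_coe_diagHom_torusPt {σ : Type*} [Fintype σ] [DecidableEq σ] (θ : σ → ℝ) :
    ((diagHom (torusPt θ) : Matrix.unitaryGroup σ ℂ) : Matrix σ σ ℂ).det =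
      Complex.exp (-((∑ l, θ l : ℝ) : ℂ) * I) := by
  rw [coe_diagHom, Matrix.det_diagonal]
  simp only [torusPt, Circle.coe_exp]
  rw [← Complex.exp_sum]
  congr 1
  push_cast
  simp only [neg_mul, Finset.sum_mul, Finset.sum_neg_distrib]

/-- **The vacuum scalar along a torus letter is a phase**: `vacScalar e (torusK a b s) = e^{i · vacRate e a b · s}`.
[folklore] -/
theorem vacScalar_torusK (e : VacExponents) (a : P → ℝ) (b : Q → ℝ) (s : ℝ) :
    vacScalar e (torusK R S a b s) = Complex.exp ((vacRate e a b * s : ℝ) * I) := by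
  simp only [vacScalar, torusK, Prod.fst_one, Prod.snd_one, OneMemClass.coe_one, Matrix.det_one, _root_.one_zpow,
    mul_one, det_coe_diagHom_torusPt, ← Complex.exp_int_mul, ← Complex.exp_add]
  congr 1
  simp only [vacRate, Pi.smul_apply, smul_eq_mul, ← Finset.mul_sum]
  push_cast
  ring

variable (R S) in
/-- **The operator of a torus letter**: `torusKOp e a b s = e^{i · vacRate · s} • torusOpPi (s • torusIdxWt a b)`.
[cite: Folland1989, Prop. (4.39)] -/
def torusKOp (e : VacExponents) (a : P → ℝ) (b : Q → ℝ) (s : ℝ) :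
    (SR (DPIdx P Q R S)) →L[ℂ] SR (DPIdx P Q R S) :=
  Complex.exp ((vacRate e a b * s : ℝ) * I) • torusOpPi (s • torusIdxWt R S a b)

variable (R S) in
/-- The generator of a torus letter. [cite: Folland1989, Prop. (4.39)] -/
def torusKGen (e : VacExponents) (a : P → ℝ) (b : Q → ℝ) : (SR (DPIdx P Q R S)) →L[ℂ] SR (DPIdx P Q R S) :=
  ((vacRate e a b : ℂ) * I) • ContinuousLinearMap.id ℂ _ + torusGenPi (torusIdxWt R S a b)

/-- **A torus letter acts by a smooth one-parameter family of Schwartz operators.** [cite: Folland1989, Prop. (4.39)] -/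
theorem isSmoothOneParam_torusKOp (e : VacExponents) (a : P → ℝ) (b : Q → ℝ) :
    IsSmoothOneParam (torusKOp R S e a b) (torusKGen R S e a b) :=
  (isSmoothOneParam_torusOpPi (torusIdxWt R S a b)).phase (vacRate e a b)

/-- **An archimedean Weil datum acts through the torus letters by `torusKOp`**: for a datum with the vacuum clause
`ω (κ k) h₀ = vacScalar e k • h₀`, `ω (κ (torusK a b s)) f = torusKOp e a b s f`.
[cite: Folland1989, §4.2 p. 156, Prop. (4.39)] -/
theorem weilDatum_apply_κ_torusK {ω : Representation ℂ (Ginf P Q R S) (SR (DPIdx P Q R S))}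
    (hW : IsArchWeilDatum (ι𝕎 P Q R S) ω) {e : VacExponents}
    (hvac : ∀ k : DPK P Q R S, ω (κ P Q R S k) (hermitePi 0) = vacScalar e k • hermitePi 0)
    (a : P → ℝ) (b : Q → ℝ) (s : ℝ) (f : SR (DPIdx P Q R S)) :
    ω (κ P Q R S (torusK R S a b s)) f = torusKOp R S e a b s f := by
  rw [apply_κ_eq_vacScalar_smul_unitaryOpPi ω hW.covariant (fun g => hW.exists_lift g) hvac, dualPairι_torusK,
    unitaryOpPi_diagHom_torusPt, vacScalar_torusK]
  rfl

/-! ## §6  The fixed `K × K′`-operators -/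

variable (R S) in
/-- **The operator of a fixed element of `K × K′`**: `κOp e k = vacScalar e k • μ₀(dualPairι k)`.
[cite: Folland1989, Prop. (4.39)] -/
def κOp (e : VacExponents) (k : DPK P Q R S) : (SR (DPIdx P Q R S)) →L[ℂ] SR (DPIdx P Q R S) :=
  vacScalar e k • unitaryOpPi (dualPairι k)

/-- **An archimedean Weil datum with vacuum clause acts on `K × K′` by `κOp`.** [cite: Folland1989, §4.2 p. 156,
Prop. (4.39)] -/
theorem weilDatum_apply_κ_eq_κOp {ω : Representation ℂ (Ginf P Q R S) (SR (DPIdx P Q R S))}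
    (hW : IsArchWeilDatum (ι𝕎 P Q R S) ω) {e : VacExponents}
    (hvac : ∀ k : DPK P Q R S, ω (κ P Q R S k) (hermitePi 0) = vacScalar e k • hermitePi 0)
    (k : DPK P Q R S) (f : SR (DPIdx P Q R S)) :
    ω (κ P Q R S k) f = κOp R S e k f :=
  apply_κ_eq_vacScalar_smul_unitaryOpPi ω hW.covariant (fun g => hW.exists_lift g) hvac k f

/-- `κOp e 1 = 1`. [folklore] -/
@[simp] theorem κOp_one (e : VacExponents) : κOp R S e (1 : DPK P Q R S) = ContinuousLinearMap.id ℂ _ := by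
  rw [κOp, vacScalar_one, one_smul, map_one, unitaryOpPi_one]

/-- `κOp e (k k') = κOp e k ∘ κOp e k'`. [folklore] -/
theorem κOp_mul (e : VacExponents) (k k' : DPK P Q R S) :
    κOp R S e (k * k') = (κOp R S e k).comp (κOp R S e k') := by
  rw [κOp, κOp, κOp, vacScalar_mul, map_mul, unitaryOpPi_mul, ContinuousLinearMap.smul_comp,
    ContinuousLinearMap.comp_smul, smul_smul]

end KLetters

end RealDualPair

end Literature.RepresentationTheory.KonnoKonno2007
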